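import Summits.CriticalPhenomena.CardyFormulaZ2.Theorems.CardyBoundaryCoulombGasBoundaryDefectGaussianRS17ConfigsNonemptyPart10

/-!
# Stub `s17_eventually_configsNonempty` of the D2 completion (line
# `rainbow-monomials-in-excursion-kernels`, crux `BoundaryDefectGaussianR`,
# stmt-CriticalPhenomena-14132) — Part 11: the prescribed levels are 1-Lipschitz near a flat
# insertion point (the straight strip)

Setting of Parts 9–10: `ι` admissible on `V`, `ds[s₀] = (x₀, k₀)` a cycle dart at an insertion
point FLAT at radius `R`, the straight run `ds[(B + e) % P] = (x₀ + (e - W) • τ, k₀)`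
(`W = R - 2`, `τ = dir (k₀+1)`, `n = dir k₀`), and `lev e` the level of the walk state at the
start of column `e - W`.

* `cnt_bound`, `cnt_cells` — the ONE-DIMENSIONAL COUNT: along the run each dart keeps the level,
  moves it by `1` (a junction: the parity flips) or by `2` (a jump edge: even on both sides), so
  `|lev j - lev i| ≤ 2 (j - i) - [lev i odd] - [lev j odd]` for `i < j`; hence for two strip cells
  — a wall face at doubled station `2 e + 1` carrying the even level `lev (e+1)`, or a wall
  vertex / ghost at station `2 e` carrying an odd level `lev e` or `lev (e+1)` — the levels differ
  by at most the difference of the stations;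
* `cs_lev_step`, `cs_face_desc`, `cs_vertex_desc`, `cs_ghost_desc` — the run of an admissible walk
  is such a sequence (step trichotomy of Part 8, parity `wired ↔ odd`), and the prescribed strip
  cells carry exactly those levels (Part 10);
* `sl_vv`, `sl_vf`, `sl_ff` — consequently the prescribed levels of any two non-free cells within
  doubled sup-distance `2 A` of `2 x₀` (`2 A + 6 ≤ R`) differ by at most their cell distance (the
  sup-norm of doubled positions dominates the station difference, `cb_dist_ge`).
Registered one-line form `s17_configsNonempty_part11` (= `cnt_bound`). All [folklore].
-/

namespace Summit.CriticalPhenomena.CardyFormulaZ2.Cruxes.BoundaryDefectGaussianR.RainbowMonomialsInExcursionKernels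

open Literature.Probability.LatticeModels Literature.Probability.LatticeModels.CollarLegModel

/-! ### The one-dimensional count -/

/-- **Levels along a run of keeps / junctions / jump edges.** If each step keeps the level, moves
it by one, or moves it by two between even levels, then for `i < j`:
`|lev j - lev i| + [lev i odd] + [lev j odd] ≤ 2 (j - i)`. [folklore] -/
theorem cnt_bound (lev : ℕ → ℤ) (E : ℕ)
    (hstep : ∀ e, e < E → lev (e + 1) = lev e ∨ (lev (e + 1) = lev e + 1 ∨ lev (e + 1) = lev e - 1) ∨
      ((lev (e + 1) = lev e + 2 ∨ lev (e + 1) = lev e - 2) ∧ lev e % 2 = 0)) :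
    ∀ i j : ℕ, i < j → j ≤ E →
      lev j - lev i + lev i % 2 + lev j % 2 ≤ 2 * ((j : ℤ) - i) ∧
        lev i - lev j + lev i % 2 + lev j % 2 ≤ 2 * ((j : ℤ) - i) := by
  intro i j hij hjE
  induction j with
  | zero => omega
  | succ j ih =>
    have hs := hstep j (by omega)
    rcases Nat.lt_or_ge i j with h | h
    · have ih' := ih h (by omega)
      push_cast at ih' ⊢
      omega
    · have hij' : i = j := by omega
      subst hij'
      push_cast
      omega

/-- **Two strip cells differ in level by at most the difference of their stations.** A cell at
station `2 e + 1` with the even level `lev (e+1)` (a wall face), or at station `2 e` with an odd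
level `lev e` or `lev (e+1)` (a wall vertex or ghost), against another such cell. [folklore] -/
theorem cnt_cells (lev : ℕ → ℤ) (E : ℕ)
    (hstep : ∀ e, e < E → lev (e + 1) = lev e ∨ (lev (e + 1) = lev e + 1 ∨ lev (e + 1) = lev e - 1) ∨
      ((lev (e + 1) = lev e + 2 ∨ lev (e + 1) = lev e - 2) ∧ lev e % 2 = 0))
    {e e' : ℕ} (he : e + 1 ≤ E) (he' : e' + 1 ≤ E) {σ σ' v v' : ℤ}
    (hc : (σ = 2 * e + 1 ∧ v = lev (e + 1) ∧ lev (e + 1) % 2 = 0) ∨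
      (σ = 2 * e ∧ ((v = lev e ∧ lev e % 2 = 1) ∨ (v = lev (e + 1) ∧ lev (e + 1) % 2 = 1))))
    (hc' : (σ' = 2 * e' + 1 ∧ v' = lev (e' + 1) ∧ lev (e' + 1) % 2 = 0) ∨
      (σ' = 2 * e' ∧ ((v' = lev e' ∧ lev e' % 2 = 1) ∨ (v' = lev (e' + 1) ∧ lev (e' + 1) % 2 = 1)))) :
    |v - v'| ≤ |σ - σ'| := by
  have B := cnt_bound lev E hstep
  rw [abs_le]
  simp only [abs_eq_max_neg]
  rcases lt_trichotomy e e' with h | rfl | h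
  · have b1 := B e e' h (by omega)
    have b2 := B e (e' + 1) (by omega) (by omega)
    have b3 := B (e + 1) (e' + 1) (by omega) (by omega)
    rcases Nat.lt_or_ge (e + 1) e' with h' | h'
    · have b4 := B (e + 1) e' h' (by omega)
      push_cast at b1 b2 b3 b4
      omega
    · have : e' = e + 1 := by omega
      subst this
      push_cast at b1 b2 b3
      omega
  · have b1 := B e (e + 1) (by omega) (by omega)
    push_cast at b1
    omega
  · have b1 := B e' e h (by omega)
    have b2 := B e' (e + 1) (by omega) (by omega)
    have b3 := B (e' + 1) (e + 1) (by omega) (by omega)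
    rcases Nat.lt_or_ge (e' + 1) e with h' | h'
    · have b4 := B (e' + 1) e h' (by omega)
      push_cast at b1 b2 b3 b4
      omega
    · have : e = e' + 1 := by omega
      subst this
      push_cast at b1 b2 b3
      omega

/-! ### Doubled positions of the strip cells -/

/-- The sup-norm of doubled positions dominates the difference of the stations along the wall.
[folklore] -/
theorem cb_dist_ge (k : Fin 4) (x₀ : ℤ × ℤ) (a a' b b' : ℤ) {p q : ℤ × ℤ}
    (hp : p = (2 : ℤ) • x₀ + a • dir (k + 1) + b • dir k)
    (hq : q = (2 : ℤ) • x₀ + a' • dir (k + 1) + b' • dir k) :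
    |a - a'| ≤ max |p.1 - q.1| |p.2 - q.2| := by
  subst hp hq
  obtain ⟨u, v⟩ := x₀
  fin_cases k <;> simp only [dir] <;> simp <;> simp only [abs_eq_max_neg] <;> omega

/-- Doubled position of a wall vertex: station `2 a`, depth `0`. [folklore] -/
theorem cb_pos_vertex (x₀ : ℤ × ℤ) (k₀ : Fin 4) (a : ℤ) :
    ((2 * (x₀ + a • dir (k₀ + 1)).1, 2 * (x₀ + a • dir (k₀ + 1)).2) : ℤ × ℤ) =
      (2 : ℤ) • x₀ + (2 * a) • dir (k₀ + 1) + (0 : ℤ) • dir k₀ := by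
  obtain ⟨u, v⟩ := x₀
  fin_cases k₀ <;> simp [dir, Prod.ext_iff] <;> ring

/-- Doubled position of a ghost above the wall: station `2 a`, depth `2`. [folklore] -/
theorem cb_pos_ghost (x₀ : ℤ × ℤ) (k₀ : Fin 4) (a : ℤ) :
    ((2 * (x₀ + a • dir (k₀ + 1) + dir k₀).1, 2 * (x₀ + a • dir (k₀ + 1) + dir k₀).2) : ℤ × ℤ) =
      (2 : ℤ) • x₀ + (2 * a) • dir (k₀ + 1) + (2 : ℤ) • dir k₀ := by
  obtain ⟨u, v⟩ := x₀
  fin_cases k₀ <;> simp [dir, Prod.ext_iff] <;> (try constructor) <;> ring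

/-- Doubled position (centre) of a wall face: station `2 a + 1`, depth `1`. [folklore] -/
theorem cb_pos_face (x₀ : ℤ × ℤ) (k₀ : Fin 4) (a : ℤ) :
    ((2 * (gapFace (x₀ + a • dir (k₀ + 1), k₀)).1 + 1, 2 * (gapFace (x₀ + a • dir (k₀ + 1), k₀)).2 + 1) :
        ℤ × ℤ) = (2 : ℤ) • x₀ + (2 * a + 1) • dir (k₀ + 1) + (1 : ℤ) • dir k₀ := by
  obtain ⟨u, v⟩ := x₀
  fin_cases k₀ <;> simp [dir, gapFace, Prod.ext_iff] <;> (try constructor) <;> ring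

/-! ### The levels along the run of an admissible walk -/

section Strip

variable (ι : LegInsertionData) (V : Finset (ℤ × ℤ)) {d₀ : Dart} (hadm : ι.IsAdmissible V)
  (h0 : outDart V ι.sink = some d₀) {st : ℕ → WalkState}
  (hst : ∀ t, st t = List.foldl (fun s d => s.step (ι.startAt V d)) ι.init ((cycle V d₀).take t))
  (hchart : ∀ u ∈ V, ∀ k : Fin 4, u + dir k ∉ V → ∃ (K : Fin 4) (c₁ c₂ : ℤ),
    (∀ v : ℤ × ℤ, |v.1 - u.1| ≤ 3 → |v.2 - u.2| ≤ 3 →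
      (v ∈ V ↔ c₂ ≤ v.1 * (dir (K + 1)).1 + v.2 * (dir (K + 1)).2)) ∨
    (∀ v : ℤ × ℤ, |v.1 - u.1| ≤ 3 → |v.2 - u.2| ≤ 3 →
      (v ∈ V ↔ c₁ ≤ v.1 * (dir K).1 + v.2 * (dir K).2 ∧
        c₂ ≤ v.1 * (dir (K + 1)).1 + v.2 * (dir (K + 1)).2)) ∨
    (∀ v : ℤ × ℤ, |v.1 - u.1| ≤ 3 → |v.2 - u.2| ≤ 3 →
      (v ∈ V ↔ c₂ ≤ v.1 * (dir (K + 1)).1 + v.2 * (dir (K + 1)).2 ∨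
        v.1 * (dir K).1 + v.2 * (dir K).2 ≤ c₁)))
  {s₀ : ℕ} (hs₀ : s₀ < (cycle V d₀).length) {x₀ : ℤ × ℤ} {k₀ : Fin 4}
  (hds₀ : (cycle V d₀)[s₀] = (x₀, k₀)) {dvec : ℤ × ℤ} {R : ℤ}
  (hd : dvec = (1, 0) ∨ dvec = (-1, 0) ∨ dvec = (0, 1) ∨ dvec = (0, -1))
  (hflat : ∀ v : ℤ × ℤ, (v.1 - x₀.1) ^ 2 + (v.2 - x₀.2) ^ 2 ≤ R ^ 2 →
    (v ∈ V ↔ 0 ≤ (v.1 - x₀.1) * dvec.1 + (v.2 - x₀.2) * dvec.2)) (hR : 4 ≤ R)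
  (lev : ℕ → ℤ)
  (hlev : ∀ e, lev e = (st ((s₀ + (cycle V d₀).length * (R - 2).toNat - (R - 2).toNat + e) %
    (cycle V d₀).length)).level)

include hadm h0 hst hlev in
/-- The state at the start of column `e + 1` follows the state after the dart of column `e`
(the seam included); and `wired ↔ odd` there. [folklore] -/
theorem cs_lev_succ (e : ℕ) :
    (st ((s₀ + (cycle V d₀).length * (R - 2).toNat - (R - 2).toNat + e) % (cycle V d₀).length + 1)).level
        = lev (e + 1) ∧
      ((st ((s₀ + (cycle V d₀).length * (R - 2).toNat - (R - 2).toNat + e) % (cycle V d₀).length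
        + 1)).wired = true ↔ lev (e + 1) % 2 = 1) ∧
      ((st ((s₀ + (cycle V d₀).length * (R - 2).toNat - (R - 2).toNat + e) %
        (cycle V d₀).length)).wired = true ↔ lev e % 2 = 1) := by
  have hP : 0 < (cycle V d₀).length := length_cycle_pos ι V hadm h0
  have hc : (s₀ + (cycle V d₀).length * (R - 2).toNat - (R - 2).toNat + e) % (cycle V d₀).length <
      (cycle V d₀).length := Nat.mod_lt _ hP
  have hmod := st_mod_succ ι V hadm h0 hst hc
  rw [Nat.mod_add_mod, show s₀ + (cycle V d₀).length * (R - 2).toNat - (R - 2).toNat + e + 1 =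
    s₀ + (cycle V d₀).length * (R - 2).toNat - (R - 2).toNat + (e + 1) by omega] at hmod
  have hw1 := st_wired_iff_odd ι V hadm h0 hst (t := (s₀ + (cycle V d₀).length * (R - 2).toNat -
    (R - 2).toNat + (e + 1)) % (cycle V d₀).length) (Nat.mod_lt _ hP).le
  have hw0 := st_wired_iff_odd ι V hadm h0 hst (t := (s₀ + (cycle V d₀).length * (R - 2).toNat -
    (R - 2).toNat + e) % (cycle V d₀).length) hc.le
  refine ⟨?_, ?_, ?_⟩
  · rw [hlev (e + 1)]; exact hmod.1.symm
  · rw [← hmod.2, hlev (e + 1)]; exact hw1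
  · rw [hlev e]; exact hw0

include hadm h0 hst hlev in
/-- **The run is a sequence of keeps / junctions / jump edges** (step trichotomy, Part 8; a jump
edge is free, hence even, on both sides). [folklore] -/
theorem cs_lev_step (e : ℕ) :
    lev (e + 1) = lev e ∨ (lev (e + 1) = lev e + 1 ∨ lev (e + 1) = lev e - 1) ∨
      ((lev (e + 1) = lev e + 2 ∨ lev (e + 1) = lev e - 2) ∧ lev e % 2 = 0) := by
  have hP : 0 < (cycle V d₀).length := length_cycle_pos ι V hadm h0
  have hc : (s₀ + (cycle V d₀).length * (R - 2).toNat - (R - 2).toNat + e) % (cycle V d₀).length <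
      (cycle V d₀).length := Nat.mod_lt _ hP
  obtain ⟨hl, -, hw0⟩ := cs_lev_succ ι V hadm h0 hst lev hlev e (s₀ := s₀) (R := R)
  rw [← hl]
  have e0 : lev e = (st ((s₀ + (cycle V d₀).length * (R - 2).toNat - (R - 2).toNat + e) %
      (cycle V d₀).length)).level := hlev e
  rcases st_step_cases ι V hst hc with ⟨hlv, -⟩ | ⟨hsgn, ⟨hlv, -⟩ | ⟨hlv, hwf, -⟩⟩
  · exact Or.inl (by rw [hlv, e0])
  · right; left
    rcases hsgn with hs | hs <;> rw [hlv, hs, e0]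
    · exact Or.inl rfl
    · exact Or.inr (by ring)
  · right; right
    refine ⟨?_, ?_⟩
    · rcases hsgn with hs | hs <;> rw [hlv, hs, e0]
      · exact Or.inl (by ring)
      · exact Or.inr (by ring)
    · rw [hwf] at hw0
      rcases Int.emod_two_eq_zero_or_one (lev e) with h | h
      · exact h
      · exact absurd (hw0.2 h) (by simp)

include hadm h0 hst hchart hds₀ hd hflat hR hlev in
/-- Descriptor of a prescribed wall face of column `e - W`: level `lev (e+1)`, even. [folklore] -/
theorem cs_face_desc (e : ℕ) (he1 : 1 ≤ e) (he2 : e + 1 ≤ 2 * (R - 2).toNat)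
    (hff : (gapFace (x₀ + ((e : ℤ) - (R - 2).toNat) • dir (k₀ + 1), k₀), true) ∉ (ι.model V).freeCells) :
    (ι.model V).C.faceH (gapFace (x₀ + ((e : ℤ) - (R - 2).toNat) • dir (k₀ + 1), k₀)) = lev (e + 1) ∧
      lev (e + 1) % 2 = 0 := by
  obtain ⟨hw, hv⟩ := cs_face_level ι V hadm h0 hst hchart hs₀ hds₀ hd hflat hR e he1 he2 hff
  obtain ⟨hl, hw1, -⟩ := cs_lev_succ ι V hadm h0 hst lev hlev e (s₀ := s₀) (R := R)
  rw [hw] at hw1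
  refine ⟨by rw [hv, hl], ?_⟩
  rcases Int.emod_two_eq_zero_or_one (lev (e + 1)) with h | h
  · exact h
  · exact absurd (hw1.2 h) (by simp)

include hadm h0 hst hds₀ hd hflat hR hlev in
/-- Descriptor of a prescribed wall vertex of column `e - W`: an odd level `lev e` or `lev (e+1)`.
[folklore] -/
theorem cs_vertex_desc (e : ℕ) (he1 : 1 ≤ e) (he2 : e + 1 ≤ 2 * (R - 2).toNat)
    (hx : x₀ + ((e : ℤ) - (R - 2).toNat) • dir (k₀ + 1) ∈ (ι.model V).vertexCells)
    (hxf : (x₀ + ((e : ℤ) - (R - 2).toNat) • dir (k₀ + 1), false) ∉ (ι.model V).freeCells) :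
    ((ι.model V).C.vertH (x₀ + ((e : ℤ) - (R - 2).toNat) • dir (k₀ + 1)) = lev e ∧ lev e % 2 = 1) ∨
      ((ι.model V).C.vertH (x₀ + ((e : ℤ) - (R - 2).toNat) • dir (k₀ + 1)) = lev (e + 1) ∧
        lev (e + 1) % 2 = 1) := by
  obtain ⟨hw, hv⟩ := cs_vertex_level ι V hadm h0 hst hs₀ hds₀ hd hflat hR e he1 he2 hx hxf
  obtain ⟨hl, hw1, hw0⟩ := cs_lev_succ ι V hadm h0 hst lev hlev e (s₀ := s₀) (R := R)
  by_cases hwe : (st ((s₀ + (cycle V d₀).length * (R - 2).toNat - (R - 2).toNat + e) %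
      (cycle V d₀).length)).wired = true
  · left; rw [hv, if_pos hwe, hlev e]; exact ⟨rfl, by rw [← hlev e]; exact hw0.1 hwe⟩
  · right; rw [hv, if_neg hwe, hl]; exact ⟨rfl, hw1.1 (hw.resolve_left hwe)⟩

include hadm h0 hst hds₀ hd hflat hR hlev in
/-- Descriptor of a prescribed ghost above column `e - W`: an odd level `lev e` or `lev (e+1)`.
[folklore] -/
theorem cs_ghost_desc (e : ℕ) (he1 : 1 ≤ e) (he2 : e + 1 ≤ 2 * (R - 2).toNat)
    (hx : x₀ + ((e : ℤ) - (R - 2).toNat) • dir (k₀ + 1) + dir k₀ ∈ (ι.model V).vertexCells)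
    (hxf : (x₀ + ((e : ℤ) - (R - 2).toNat) • dir (k₀ + 1) + dir k₀, false) ∉ (ι.model V).freeCells) :
    ((ι.model V).C.vertH (x₀ + ((e : ℤ) - (R - 2).toNat) • dir (k₀ + 1) + dir k₀) = lev e ∧
        lev e % 2 = 1) ∨
      ((ι.model V).C.vertH (x₀ + ((e : ℤ) - (R - 2).toNat) • dir (k₀ + 1) + dir k₀) = lev (e + 1) ∧
        lev (e + 1) % 2 = 1) := by
  obtain ⟨hw, hv⟩ := cs_ghost_level ι V hadm h0 hst hs₀ hds₀ hd hflat hR e he1 he2 hx hxf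
  obtain ⟨hl, hw1, hw0⟩ := cs_lev_succ ι V hadm h0 hst lev hlev e (s₀ := s₀) (R := R)
  by_cases hwe : (st ((s₀ + (cycle V d₀).length * (R - 2).toNat - (R - 2).toNat + e) %
      (cycle V d₀).length)).wired = true
  · left; rw [hv, if_pos hwe, hlev e]; exact ⟨rfl, by rw [← hlev e]; exact hw0.1 hwe⟩
  · right; rw [hv, if_neg hwe, hl]; exact ⟨rfl, hw1.1 (hw.resolve_left hwe)⟩

/-! ### The strip Lipschitz lemmas -/

include hadm h0 hst hds₀ hd hflat hR hlev in
/-- **A prescribed vertex-cell near `x₀`, as a strip cell**: a column index `e` with station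
`2 e` such that the doubled position is `2 x₀ + (2 e - 2 W) • τ + β • n` (`β ∈ {0, 2}`) and
`vertH` is an odd level `lev e` or `lev (e+1)`. [folklore] -/
theorem sl_vertex_cell {A : ℤ} (hA : 0 ≤ A) (hAR : 2 * A + 6 ≤ R) {x : ℤ × ℤ}
    (hx : x ∈ (ι.model V).vertexCells) (hxf : (x, false) ∉ (ι.model V).freeCells)
    (hnear : |2 * x.1 - 2 * x₀.1| ≤ 2 * A ∧ |2 * x.2 - 2 * x₀.2| ≤ 2 * A) :
    ∃ (e : ℕ) (β : ℤ), 1 ≤ e ∧ e + 1 ≤ 2 * (R - 2).toNat ∧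
      ((2 * x.1, 2 * x.2) : ℤ × ℤ) = (2 : ℤ) • x₀ + (2 * ((e : ℤ) - (R - 2).toNat)) • dir (k₀ + 1) + β • dir k₀ ∧
      (((ι.model V).C.vertH x = lev e ∧ lev e % 2 = 1) ∨
        ((ι.model V).C.vertH x = lev (e + 1) ∧ lev (e + 1) % 2 = 1)) := by
  have hk₀ : x₀ + dir k₀ ∉ V := by
    have := (cycle_getElem_exterior ι V hadm h0 hs₀).2; rwa [hds₀] at this
  obtain ⟨a, ha, hcl⟩ := cb_vertex_class ι V hadm h0 hst hd hflat (by omega) hk₀ hA (by nlinarith) hx hxf hnear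
  rw [abs_le] at ha
  set e : ℕ := (a + (R - 2).toNat).toNat with hedef
  have he : (e : ℤ) - (R - 2).toNat = a := by rw [hedef]; omega
  refine ⟨e, ?_⟩
  rcases hcl with ⟨hxe, -⟩ | ⟨hxe, -⟩
  · refine ⟨0, by omega, by omega, ?_, ?_⟩
    · rw [he]; conv_lhs => rw [hxe]
      exact cb_pos_vertex x₀ k₀ a
    · have hx' : x₀ + ((e : ℤ) - (R - 2).toNat) • dir (k₀ + 1) ∈ (ι.model V).vertexCells := by rwa [he, ← hxe]
      have hxf' : (x₀ + ((e : ℤ) - (R - 2).toNat) • dir (k₀ + 1), false) ∉ (ι.model V).freeCells := by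
        rwa [he, ← hxe]
      have := cs_vertex_desc ι V hadm h0 hst hs₀ hds₀ hd hflat hR lev hlev e (by omega) (by omega) hx' hxf'
      rwa [he, ← hxe] at this
  · refine ⟨2, by omega, by omega, ?_, ?_⟩
    · rw [he]; conv_lhs => rw [hxe]
      exact cb_pos_ghost x₀ k₀ a
    · have hx' : x₀ + ((e : ℤ) - (R - 2).toNat) • dir (k₀ + 1) + dir k₀ ∈ (ι.model V).vertexCells := by
        rwa [he, ← hxe]
      have hxf' : (x₀ + ((e : ℤ) - (R - 2).toNat) • dir (k₀ + 1) + dir k₀, false) ∉ (ι.model V).freeCells := by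
        rwa [he, ← hxe]
      have := cs_ghost_desc ι V hadm h0 hst hs₀ hds₀ hd hflat hR lev hlev e (by omega) (by omega) hx' hxf'
      rwa [he, ← hxe] at this

include hadm h0 hst hchart hds₀ hd hflat hR hlev in
/-- **A prescribed face-cell near `x₀`, as a strip cell**: a column index `e` with station
`2 e + 1`, doubled centre `2 x₀ + (2 e - 2 W + 1) • τ + n`, and the even level `lev (e+1)`.
[folklore] -/
theorem sl_face_cell {A : ℤ} (hA : 0 ≤ A) (hAR : 2 * A + 6 ≤ R) {f : ℤ × ℤ}
    (hfc : f ∈ (ι.model V).faceCells) (hff : (f, true) ∉ (ι.model V).freeCells)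
    (hnear : |2 * f.1 + 1 - 2 * x₀.1| ≤ 2 * A ∧ |2 * f.2 + 1 - 2 * x₀.2| ≤ 2 * A) :
    ∃ e : ℕ, 1 ≤ e ∧ e + 1 ≤ 2 * (R - 2).toNat ∧
      ((2 * f.1 + 1, 2 * f.2 + 1) : ℤ × ℤ) =
        (2 : ℤ) • x₀ + (2 * ((e : ℤ) - (R - 2).toNat) + 1) • dir (k₀ + 1) + (1 : ℤ) • dir k₀ ∧
      (ι.model V).C.faceH f = lev (e + 1) ∧ lev (e + 1) % 2 = 0 := by
  have hk₀ : x₀ + dir k₀ ∉ V := by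
    have := (cycle_getElem_exterior ι V hadm h0 hs₀).2; rwa [hds₀] at this
  obtain ⟨a, ha, hfa⟩ := cb_face_class ι V hd hflat (by omega) hk₀ hA (by nlinarith) hfc hff hnear
  rw [abs_le] at ha
  set e : ℕ := (a + (R - 2).toNat).toNat with hedef
  have he : (e : ℤ) - (R - 2).toNat = a := by rw [hedef]; omega
  refine ⟨e, by omega, by omega, ?_, ?_⟩
  · rw [he, hfa]; exact cb_pos_face x₀ k₀ a
  · have hff' : (gapFace (x₀ + ((e : ℤ) - (R - 2).toNat) • dir (k₀ + 1), k₀), true) ∉ (ι.model V).freeCells := by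
      rwa [he, ← hfa]
    have := cs_face_desc ι V hadm h0 hst hchart hs₀ hds₀ hd hflat hR lev hlev e (by omega) (by omega) hff'
    rwa [he, ← hfa] at this

include hadm h0 hst hds₀ hd hflat hR hlev in
/-- **Vertex against vertex near a flat insertion point.** [folklore] -/
theorem sl_vv {A : ℤ} (hA : 0 ≤ A) (hAR : 2 * A + 6 ≤ R) {x y : ℤ × ℤ}
    (hx : x ∈ (ι.model V).vertexCells) (hxf : (x, false) ∉ (ι.model V).freeCells)
    (hy : y ∈ (ι.model V).vertexCells) (hyf : (y, false) ∉ (ι.model V).freeCells)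
    (hxn : |2 * x.1 - 2 * x₀.1| ≤ 2 * A ∧ |2 * x.2 - 2 * x₀.2| ≤ 2 * A)
    (hyn : |2 * y.1 - 2 * x₀.1| ≤ 2 * A ∧ |2 * y.2 - 2 * x₀.2| ≤ 2 * A) :
    (ι.model V).C.vertH x - (ι.model V).C.vertH y ≤ max |2 * x.1 - 2 * y.1| |2 * x.2 - 2 * y.2| := by
  obtain ⟨e, β, he1, he2, hp, hc⟩ := sl_vertex_cell ι V hadm h0 hst hs₀ hds₀ hd hflat hR lev hlev hA hAR hx hxf hxn
  obtain ⟨e', β', he1', he2', hq, hc'⟩ := sl_vertex_cell ι V hadm h0 hst hs₀ hds₀ hd hflat hR lev hlev hA hAR hy hyf hyn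
  have hstep := fun e (_ : e < 2 * (R - 2).toNat) => cs_lev_step ι V hadm h0 hst lev hlev e (s₀ := s₀) (R := R)
  have h1 := cnt_cells lev (2 * (R - 2).toNat) hstep he2 he2' (σ := 2 * e) (σ' := 2 * e')
    (Or.inr ⟨rfl, hc⟩) (Or.inr ⟨rfl, hc'⟩)
  have h2 := cb_dist_ge k₀ x₀ _ _ β β' hp hq
  have h3 : |(2 * e : ℤ) - 2 * e'| = |2 * ((e : ℤ) - (R - 2).toNat) - 2 * ((e' : ℤ) - (R - 2).toNat)| := by
    congr 1; ring
  rw [h3] at h1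
  exact (le_abs_self _).trans (h1.trans h2)

include hadm h0 hst hchart hds₀ hd hflat hR hlev in
/-- **Vertex against face near a flat insertion point.** [folklore] -/
theorem sl_vf {A : ℤ} (hA : 0 ≤ A) (hAR : 2 * A + 6 ≤ R) {x g : ℤ × ℤ}
    (hx : x ∈ (ι.model V).vertexCells) (hxf : (x, false) ∉ (ι.model V).freeCells)
    (hg : g ∈ (ι.model V).faceCells) (hgf : (g, true) ∉ (ι.model V).freeCells)
    (hxn : |2 * x.1 - 2 * x₀.1| ≤ 2 * A ∧ |2 * x.2 - 2 * x₀.2| ≤ 2 * A)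
    (hgn : |2 * g.1 + 1 - 2 * x₀.1| ≤ 2 * A ∧ |2 * g.2 + 1 - 2 * x₀.2| ≤ 2 * A) :
    |(ι.model V).C.vertH x - (ι.model V).C.faceH g| ≤
      max |2 * x.1 - (2 * g.1 + 1)| |2 * x.2 - (2 * g.2 + 1)| := by
  obtain ⟨e, β, he1, he2, hp, hc⟩ := sl_vertex_cell ι V hadm h0 hst hs₀ hds₀ hd hflat hR lev hlev hA hAR hx hxf hxn
  obtain ⟨e', he1', he2', hq, hv', hpar'⟩ := sl_face_cell ι V hadm h0 hst hchart hs₀ hds₀ hd hflat hR lev hlev hA hAR hg hgf hgn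
  have hstep := fun e (_ : e < 2 * (R - 2).toNat) => cs_lev_step ι V hadm h0 hst lev hlev e (s₀ := s₀) (R := R)
  have h1 := cnt_cells lev (2 * (R - 2).toNat) hstep he2 he2' (σ := 2 * e) (σ' := 2 * e' + 1)
    (Or.inr ⟨rfl, hc⟩) (Or.inl ⟨rfl, hv', hpar'⟩)
  have h2 := cb_dist_ge k₀ x₀ _ _ β 1 hp hq
  have h3 : |(2 * e : ℤ) - (2 * e' + 1)| =
      |2 * ((e : ℤ) - (R - 2).toNat) - (2 * ((e' : ℤ) - (R - 2).toNat) + 1)| := by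
    congr 1; ring
  rw [h3] at h1
  exact h1.trans h2

include hadm h0 hst hchart hds₀ hd hflat hR hlev in
/-- **Face against face near a flat insertion point.** [folklore] -/
theorem sl_ff {A : ℤ} (hA : 0 ≤ A) (hAR : 2 * A + 6 ≤ R) {f g : ℤ × ℤ}
    (hf : f ∈ (ι.model V).faceCells) (hff : (f, true) ∉ (ι.model V).freeCells)
    (hg : g ∈ (ι.model V).faceCells) (hgf : (g, true) ∉ (ι.model V).freeCells)
    (hfn : |2 * f.1 + 1 - 2 * x₀.1| ≤ 2 * A ∧ |2 * f.2 + 1 - 2 * x₀.2| ≤ 2 * A)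
    (hgn : |2 * g.1 + 1 - 2 * x₀.1| ≤ 2 * A ∧ |2 * g.2 + 1 - 2 * x₀.2| ≤ 2 * A) :
    (ι.model V).C.faceH f - (ι.model V).C.faceH g ≤ max |2 * f.1 - 2 * g.1| |2 * f.2 - 2 * g.2| := by
  obtain ⟨e, he1, he2, hp, hv, hpar⟩ := sl_face_cell ι V hadm h0 hst hchart hs₀ hds₀ hd hflat hR lev hlev hA hAR hf hff hfn
  obtain ⟨e', he1', he2', hq, hv', hpar'⟩ := sl_face_cell ι V hadm h0 hst hchart hs₀ hds₀ hd hflat hR lev hlev hA hAR hg hgf hgn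
  have hstep := fun e (_ : e < 2 * (R - 2).toNat) => cs_lev_step ι V hadm h0 hst lev hlev e (s₀ := s₀) (R := R)
  have h1 := cnt_cells lev (2 * (R - 2).toNat) hstep he2 he2' (σ := 2 * e + 1) (σ' := 2 * e' + 1)
    (Or.inl ⟨rfl, hv, hpar⟩) (Or.inl ⟨rfl, hv', hpar'⟩)
  have h2 := cb_dist_ge k₀ x₀ _ _ 1 1 hp hq
  have h3 : |(2 * e + 1 : ℤ) - (2 * e' + 1)| =
      |2 * ((e : ℤ) - (R - 2).toNat) + 1 - (2 * ((e' : ℤ) - (R - 2).toNat) + 1)| := by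
    congr 1; ring
  have h4 : max |((2 * f.1 + 1, 2 * f.2 + 1) : ℤ × ℤ).1 - ((2 * g.1 + 1, 2 * g.2 + 1) : ℤ × ℤ).1|
      |((2 * f.1 + 1, 2 * f.2 + 1) : ℤ × ℤ).2 - ((2 * g.1 + 1, 2 * g.2 + 1) : ℤ × ℤ).2| =
      max |2 * f.1 - 2 * g.1| |2 * f.2 - 2 * g.2| := by
    congr 1 <;> (congr 1; simp only; ring)
  rw [h3] at h1
  rw [h4] at h2
  exact (le_abs_self _).trans (h1.trans h2)

end Strip

/-! ### Registered one-line form -/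

/-- **Registered sub-goal `s17_configsNonempty_part11`** of `s17_eventually_configsNonempty`
(stmt-CriticalPhenomena-14132): the one-dimensional count — along a sequence of keeps, unit moves
and even double moves, `|lev j - lev i| + [lev i odd] + [lev j odd] ≤ 2 (j - i)` for `i < j`
(one-line form of `cnt_bound`). [folklore] -/
theorem s17_configsNonempty_part11 : ∀ (lev : ℕ → ℤ) (E : ℕ), (∀ e, e < E → lev (e + 1) = lev e ∨ (lev (e + 1) = lev e + 1 ∨ lev (e + 1) = lev e - 1) ∨ ((lev (e + 1) = lev e + 2 ∨ lev (e + 1) = lev e - 2) ∧ lev e % 2 = 0)) → ∀ i j : ℕ, i < j → j ≤ E → lev j - lev i + lev i % 2 + lev j % 2 ≤ 2 * ((j : ℤ) - i) ∧ lev i - lev j + lev i % 2 + lev j % 2 ≤ 2 * ((j : ℤ) - i) :=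
  fun lev E hstep i j hij hjE => cnt_bound lev E hstep i j hij hjE

end Summit.CriticalPhenomena.CardyFormulaZ2.Cruxes.BoundaryDefectGaussianR.RainbowMonomialsInExcursionKernels
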